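import Summits.QuantumFields.BalabanUV.Beta.FP.AdInvariantColourVectors
import Summits.QuantumFields.BalabanUV.Beta.ColourBasisSU

/-!
# `BalabanUV.Beta.FP.AdInvariantColourCoords` — **NO Ad_{SU(N)}-INVARIANT COVECTOR IN tr-COORDINATES** (β sub-cell, road «FP», sub-row
# GAMMA-0c (S4-AD) item (i), GROUP half «(i-G)» PART 2: the letter `hno` of `FP/TadpoleAdInvariance` in the currency `(C → ℝ) → ℝ` it is typed in)

HONEST FRAMING (cell charter, verbatim): «discharging BetaPertH makes Balaban's UV stability UNCONDITIONAL — a real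
constructive-QFT result; it is NOT the continuum limit and NOT the Clay problem.»  Neutral finite linear algebra ([folklore]; no
statement of Bałaban's papers, no `[cite:]`, no `Prop` fact, no `def`); it instantiates 0∕4 row-D1 binders.  NOT D1, NOT `BetaPertH`,
NOT continuum, NOT Clay.  HONEST DEPENDENCY: continuum YM on T⁴ ⇐ BetaPertH ∧ nine spine estimates (0/9 proved); BetaPertH ⇐ (D1) ∧
(D4) ∧ CAP+tail; G-an2-4 gates asym, D1 and NE2/3/4.

WHAT.  `FP/TadpoleAdInvariance.tadpole_eq_zero_of_noInvariantCovector` (GAMMA-0c (ii)+(iii), beta-d1-formalise-leaf-05) displays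
`hno : ∀ T : (κ → ℝ) → ℝ, additive → ℝ-homogeneous → (∀ g w, T (ρg g w) = T w) → ∀ w, T w = 0` over a REAL coordinate space.  For ONE colour
site the road's coordinates are Bałaban's components `B^a` in a tr-orthonormal Hermitian generator family `τ : C → Mat_N(ℂ)` (`Beta.ColourTrace`
convention (C2): `Complete τ`, `TrOrthonormal τ`), and the symmetry is global colour rotation `X ↦ U X Uᴴ`, `U ∈ SU(N)`.  This module transports
the GROUP-level matrix theorem `AdInvariantColourVectors.covector_eq_zero_of_conj_invariant'` to these coordinates: with the tr-coordinate map
`X ↦ (c ↦ Re Tr(X τ_c) ∕ N)` and the coordinate field `x ↦ Σ_c x_c τ_c` (mutually inverse on 𝔤 = Hermitian traceless, §1), an additive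
ℝ-homogeneous `T : (C → ℝ) → ℝ` invariant under `x ↦ coords (U (Σ_c x_c τ_c) Uᴴ)` for all `U ∈ SU(N)` VANISHES IDENTICALLY — no side condition,
since the coordinates parametrise exactly 𝔤 (§2 `coord_covector_eq_zero_of_conj_invariant`; `hno_coords` = the letter VERBATIM with
`G := ↥(Matrix.specialUnitaryGroup (Fin N) ℂ)`, `ρg g w := coords (g (Σ_c w_c τ_c) gᴴ)`); instances with no hypothesis left: an3's family of
record `ColourBasisSU.suGen N` (every `N ≠ 0`) and lit1's `ColourTrace.pauli` (SU(2)) (§3).  The sibling `FP/TadpoleAdInvarianceColour`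
(t4-ne7b-formalise-leaf-09-g20) is the INFINITESIMAL ∕ structure-constant form; zero overlap.

NOT HERE: the bondwise reduction from the road's full fine space `κ = bonds × C` to one site (additivity of `T` + single-bond test fields —
the road instance's one-liner); the road's Ad-EQUIVARIANCE of `Hf, Qf` (S4-AD itself); anything of Bałaban's series.  Provenance: NE7b formalise
swarm leaf-04 gen 20, cross-cell kernel duty for road FP (owner b2b-balaban-beta-d1-p3), 2026-08-21; no existing file touched.
-/

namespace Summit.QuantumFields.BalabanUV.Beta.FP.AdInvariantColourCoords

open Matrix Complex
open Literature.MathematicalPhysics.QuantumFieldTheory.Balaban1983to89 (B9AdOrthogonal.GMIndex B9AdOrthogonal.im_trace_mul_eq_zero)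
open Literature.MathematicalPhysics.QuantumFieldTheory.Balaban1983to89.Beta.ColourTrace (Complete TrOrthonormal expansion_of_complete
  trace_gen_eq_zero pauli pauli_complete pauli_trOrthonormal pauli_isHermitian)
open Summit.QuantumFields.BalabanUV.Beta.ColourBasisSU (suGen suGen_complete suGen_trOrthonormal suGen_isHermitian)
open Summit.QuantumFields.BalabanUV.Beta.FP.AdInvariantColourVectors (covector_eq_zero_of_conj_invariant')

variable {N : ℕ} {C : Type*} [Fintype C]

/-! ## §1 The tr-coordinate dictionary on 𝔤 -/

/-- [folklore] `Tr((Σ_d x_d τ_d)·τ_c) = N·x_c` for a tr-orthonormal family. -/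
theorem trace_ofCoords_mul_gen [DecidableEq C] {τ : C → Matrix (Fin N) (Fin N) ℂ} (ho : TrOrthonormal τ) (x : C → ℝ) (c : C) :
    ((∑ d, ((x d : ℝ) : ℂ) • τ d) * τ c).trace = (N : ℂ) * x c := by
  rw [Finset.sum_mul, trace_sum]
  simp only [smul_mul_assoc, trace_smul, smul_eq_mul]
  have : ∀ d, ((x d : ℝ) : ℂ) * (τ d * τ c).trace = if d = c then ((x d : ℝ) : ℂ) * N else 0 := fun d => by
    rw [ho d c]; split_ifs <;> simp
  simp only [this, Finset.sum_ite_eq', Finset.mem_univ, if_true]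
  ring

/-- [folklore] COORDINATES OF A COORDINATE FIELD: `Re Tr((Σ_d x_d τ_d) τ_c) ∕ N = x_c` (`N ≠ 0`). -/
theorem coords_ofCoords [DecidableEq C] {τ : C → Matrix (Fin N) (Fin N) ℂ} (ho : TrOrthonormal τ) (hN : N ≠ 0) (x : C → ℝ) :
    (fun c => ((∑ d, ((x d : ℝ) : ℂ) • τ d) * τ c).trace.re / N) = x := by
  funext c
  rw [trace_ofCoords_mul_gen ho]
  have hN' : (N : ℝ) ≠ 0 := Nat.cast_ne_zero.mpr hN
  simp only [Complex.mul_re, Complex.natCast_re, Complex.natCast_im, Complex.ofReal_re, Complex.ofReal_im, zero_mul, sub_zero]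
  field_simp

omit [Fintype C] in
/-- [folklore] For Hermitian `X` and Hermitian generators the trace coordinate is REAL: `(Re Tr(Xτ_c) : ℂ) = Tr(Xτ_c)`. -/
theorem coe_re_trace_mul_gen {τ : C → Matrix (Fin N) (Fin N) ℂ} (hH : ∀ c, (τ c).IsHermitian) {X : Matrix (Fin N) (Fin N) ℂ}
    (hX : X.IsHermitian) (c : C) : (((X * τ c).trace.re : ℝ) : ℂ) = (X * τ c).trace := by
  apply Complex.ext
  · simp
  · rw [Complex.ofReal_im]; exact (B9AdOrthogonal.im_trace_mul_eq_zero hX (hH c)).symm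

/-- [folklore] THE FIELD OF THE COORDINATES: for a complete Hermitian family and a Hermitian TRACELESS `X`, `Σ_c (Re Tr(Xτ_c)∕N)·τ_c = X`. -/
theorem ofCoords_coords {τ : C → Matrix (Fin N) (Fin N) ℂ} (hτ : Complete τ) (hH : ∀ c, (τ c).IsHermitian) (hN : N ≠ 0)
    {X : Matrix (Fin N) (Fin N) ℂ} (hX : X.IsHermitian) (h0 : X.trace = 0) :
    ∑ c, ((((X * τ c).trace.re / N : ℝ)) : ℂ) • τ c = X := by
  have hN' : (N : ℂ) ≠ 0 := Nat.cast_ne_zero.mpr hN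
  have h1 : ∀ c, ((((X * τ c).trace.re / N : ℝ)) : ℂ) • τ c = (N : ℂ)⁻¹ • ((X * τ c).trace • τ c) := fun c => by
    rw [smul_smul, Complex.ofReal_div, coe_re_trace_mul_gen hH hX, Complex.ofReal_natCast, div_eq_inv_mul]
  simp only [h1]
  rw [← Finset.smul_sum, expansion_of_complete hτ h0, smul_smul, inv_mul_cancel₀ hN', one_smul]

/-- [folklore] A real coordinate field is Hermitian … -/
theorem isHermitian_ofCoords {τ : C → Matrix (Fin N) (Fin N) ℂ} (hH : ∀ c, (τ c).IsHermitian) (x : C → ℝ) :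
    (∑ d, ((x d : ℝ) : ℂ) • τ d).IsHermitian := by
  unfold Matrix.IsHermitian
  rw [conjTranspose_sum]
  refine Finset.sum_congr rfl fun d _ => ?_
  rw [conjTranspose_smul, (hH d).eq, Complex.star_def, Complex.conj_ofReal]

/-- [folklore] … and traceless (complete tr-orthonormal family, `N ≠ 0`: the generators are traceless). -/
theorem trace_ofCoords [DecidableEq C] {τ : C → Matrix (Fin N) (Fin N) ℂ} (hτ : Complete τ) (ho : TrOrthonormal τ) (hN : N ≠ 0) (x : C → ℝ) :
    (∑ d, ((x d : ℝ) : ℂ) • τ d).trace = 0 := by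
  rw [trace_sum]
  exact Finset.sum_eq_zero fun d _ => by rw [trace_smul, trace_gen_eq_zero hτ ho hN d, smul_zero]

/-! ## §2 The letter `hno` in tr-coordinates -/

/-- [folklore] **NO Ad_{SU(N)}-INVARIANT COVECTOR IN tr-COORDINATES** — the shape of `TadpoleAdInvariance`'s `hno` at one colour site, with
`ρg U x := tr-coords of U(Σ_c x_cτ_c)Uᴴ`: for a Hermitian, complete, tr-orthonormal family (`N ≠ 0`), every additive ℝ-homogeneous
`T : (C → ℝ) → ℝ` invariant under all `U ∈ SU(N)` is identically zero. -/
theorem coord_covector_eq_zero_of_conj_invariant [DecidableEq C] {τ : C → Matrix (Fin N) (Fin N) ℂ} (hτ : Complete τ) (ho : TrOrthonormal τ)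
    (hH : ∀ c, (τ c).IsHermitian) (hN : N ≠ 0) (T : (C → ℝ) → ℝ) (hadd : ∀ x y, T (x + y) = T x + T y)
    (hsmul : ∀ (r : ℝ) x, T (r • x) = r * T x)
    (hT : ∀ U : Matrix (Fin N) (Fin N) ℂ, U ∈ Matrix.specialUnitaryGroup (Fin N) ℂ → ∀ x : C → ℝ,
      T (fun c => (U * (∑ d, ((x d : ℝ) : ℂ) • τ d) * star U * τ c).trace.re / N) = T x)
    (x : C → ℝ) : T x = 0 := by
  -- the matrix-level functional `T̃ X := T (coords X)`
  have key := covector_eq_zero_of_conj_invariant' (N := N) (fun X => T (fun c => (X * τ c).trace.re / N))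
    (fun X Y => by
      rw [← hadd]
      congr 1
      funext c
      simp only [Pi.add_apply, Matrix.add_mul, trace_add, Complex.add_re, add_div])
    (fun r X => by
      rw [← hsmul]
      congr 1
      funext c
      simp only [Pi.smul_apply, Matrix.smul_mul, trace_smul, smul_eq_mul, Complex.real_smul, Complex.re_ofReal_mul,
        mul_div_assoc])
    (fun U hU X hX h0 => by
      have h := hT U hU (fun c => (X * τ c).trace.re / N)
      rw [ofCoords_coords hτ hH hN hX h0] at h
      exact h)
    (isHermitian_ofCoords hH x) (trace_ofCoords hτ ho hN x)
  rwa [coords_ofCoords ho hN x] at key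

/-- [folklore] **THE LETTER `hno` VERBATIM** (binder shape of `TadpoleAdInvariance.tadpole_eq_zero_of_noInvariantCovector`, one colour
site): with `G := ↥(Matrix.specialUnitaryGroup (Fin N) ℂ)` and `ρg g w := tr-coords of g(Σ_c w_cτ_c)gᴴ`, every additive ℝ-homogeneous
`ρg`-invariant `T : (C → ℝ) → ℝ` vanishes identically. -/
theorem hno_coords [DecidableEq C] {τ : C → Matrix (Fin N) (Fin N) ℂ} (hτ : Complete τ) (ho : TrOrthonormal τ)
    (hH : ∀ c, (τ c).IsHermitian) (hN : N ≠ 0) :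
    ∀ T : (C → ℝ) → ℝ, (∀ w w', T (w + w') = T w + T w') → (∀ (r : ℝ) w, T (r • w) = r * T w) →
      (∀ (g : Matrix.specialUnitaryGroup (Fin N) ℂ) (w : C → ℝ),
        T (fun c => ((g : Matrix (Fin N) (Fin N) ℂ) * (∑ d, ((w d : ℝ) : ℂ) • τ d) * star (g : Matrix (Fin N) (Fin N) ℂ) *
          τ c).trace.re / N) = T w) →
      ∀ w, T w = 0 :=
  fun T hadd hsmul hT w => coord_covector_eq_zero_of_conj_invariant hτ ho hH hN T hadd hsmul (fun U hU x => hT ⟨U, hU⟩ x) w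

/-! ## §3 Instances with no hypothesis left -/

/-- [folklore] **an3's family of record `suGen N`, every `N ≠ 0`**: an additive ℝ-homogeneous `T : (GMIndex N → ℝ) → ℝ` invariant under global
`SU(N)` colour rotation in tr-coordinates vanishes. -/
theorem coord_covector_eq_zero_suGen (hN : N ≠ 0) (T : (B9AdOrthogonal.GMIndex N → ℝ) → ℝ) (hadd : ∀ x y, T (x + y) = T x + T y)
    (hsmul : ∀ (r : ℝ) x, T (r • x) = r * T x)
    (hT : ∀ U : Matrix (Fin N) (Fin N) ℂ, U ∈ Matrix.specialUnitaryGroup (Fin N) ℂ → ∀ x : B9AdOrthogonal.GMIndex N → ℝ,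
      T (fun c => (U * (∑ d, ((x d : ℝ) : ℂ) • suGen N d) * star U * suGen N c).trace.re / N) = T x)
    (x : B9AdOrthogonal.GMIndex N → ℝ) : T x = 0 :=
  coord_covector_eq_zero_of_conj_invariant (suGen_complete hN) (suGen_trOrthonormal N) suGen_isHermitian hN T hadd hsmul hT x

/-- [folklore] **SU(2) in the Pauli family**: the same over `ColourTrace.pauli` (`N = 2`, `C = Fin 3`). -/
theorem coord_covector_eq_zero_pauli (T : (Fin 3 → ℝ) → ℝ) (hadd : ∀ x y, T (x + y) = T x + T y)
    (hsmul : ∀ (r : ℝ) x, T (r • x) = r * T x)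
    (hT : ∀ U : Matrix (Fin 2) (Fin 2) ℂ, U ∈ Matrix.specialUnitaryGroup (Fin 2) ℂ → ∀ x : Fin 3 → ℝ,
      T (fun c => (U * (∑ d, ((x d : ℝ) : ℂ) • pauli d) * star U * pauli c).trace.re / (2 : ℕ)) = T x)
    (x : Fin 3 → ℝ) : T x = 0 :=
  coord_covector_eq_zero_of_conj_invariant pauli_complete pauli_trOrthonormal pauli_isHermitian two_ne_zero T hadd hsmul hT x

end Summit.QuantumFields.BalabanUV.Beta.FP.AdInvariantColourCoords
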